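import Summits.QuantumAdvantage.QuantumAdvantage.Theorems.LinnikCubicClassGroupsDegreeOnePrimesEscapeCubicChebotarevInputs
import Summits.QuantumAdvantage.QuantumAdvantage.Theorems.LinnikCubicClassGroupsDegreeOnePrimesEscapeCubicSplittingTheta
import Summits.QuantumAdvantage.QuantumAdvantage.Theorems.LinnikCubicClassGroupsDegreeOnePrimesEscapeCubicClosure
import HarnessLib

/-!
# Primes of prescribed splitting type in cubic fields, `≤ |d_K|^L`, unconditionally

Topic `Summits/QuantumAdvantage/QuantumAdvantage/Theorems`, cell B2b-1 (linnik-cubic), PART A (gen 7);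
helper toward the crux `DegreeOnePrimesEscape` (stmt-QuantumAdvantage-11543) of route
`LinnikCubicClassGroups`.  HONEST FRAMING: the value of this file is a THEOREM (kernel-checked, GRH-free,
Siegel-free, no hypothesis) — NOT summit progress.

Two Chebotarev–Linnik statements [LagariasMontgomeryOdlyzko1979] obtained by counting splitting types:

* `exists_partialPrime_le` — for every NON-Galois cubic field `K` there is a prime `p ≤ |d_K|^{L}`,
  `p ∤ d_K`, of splitting type `(1,2)` (`p = 𝔭₁𝔭₂`, residue degrees `1` and `2`; Frobenius = a
  transposition of `S₃`; equivalently `p` is inert in the quadratic resolvent):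
  `2·Σ_{p of type (1,2)} log p ≥ 2θ(x) − θ¹_k(x) − 2 log|d_N|` with `θ_k(x) ≤ 1.1 x` UNIFORMLY over
  quadratic fields (`chebyshevThetaIdeal_le_uniform`; an exceptional zero only makes the primes inert in
  `k` more numerous);
* `exists_inertPrime_le_of_isGalois` — for every CYCLIC cubic field `K` there is an INERT prime
  `p ≤ |d_K|^{L}` (`p𝓞_K` prime; Frobenius `≠ 1`, density `2/3`):
  `3·Σ_{p inert} log p ≥ 3θ(x) − θ¹_K(x) − 3 log|d_K|` with `θ_K(x) ≤ 1.1 x` uniformly over cubic fields.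

Placement (presearch 2026-08-19): the statement is KNOWN in print with explicit exponents — Lagarias–
Montgomery–Odlyzko 1979 (`p ≪ d_N^{c}`), Cho–Kim (sign changes of modular/Maass forms: `α(S₃,[(123)]) =
3/16`, resp. `1/4 − δ`) and P. J. Cho, R. J. Lemke Oliver, A. Zaman, *The least prime with a given cycle
type*, arXiv:2512.24963 (2025, zero-free method, all `S_n`).  What is new here is only the KERNEL-CHECKED
proof, by the classical zero-density/Deuring–Heilbronn route of this cell, with an inexplicit exponent.

The complementary statements — the least completely split prime (B-g6, `exists_splitsCompletely_le_discr`,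
for Galois fields) and the least inert prime of a pure cubic field (`exists_inertPrime_le_of_cubeRoot`) —
are in the sibling files.
-/

noncomputable section

open scoped NumberField nonZeroDivisors
open Finset Real Ideal NumberField
open Literature.NumberTheory.NumberFields Literature.NumberTheory.LFunctions
  Literature.NumberTheory.LFunctions.NumberField

namespace Summit.QuantumAdvantage.QuantumAdvantage.Theorems.DegreeOnePrimesEscape

/-! ### Thresholds -/

/-- **Choice of the exponent.** Given `e, a ≥ 0`, `x₀` and `B ≥ 0` there is `L > 0` such that for
every `d ≥ 3`, `x = d^L` satisfies `x ≥ x₀`, `x ≥ (d^e)^a` and `x ≥ B d`. -/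
theorem exists_exponent_rpow (e a x₀ B : ℝ) (he : 0 ≤ e) (ha : 0 ≤ a) :
    ∃ L : ℝ, 0 < L ∧ ∀ d : ℝ, 3 ≤ d →
      x₀ ≤ d ^ L ∧ (d ^ e) ^ a ≤ d ^ L ∧ B * d ≤ d ^ L := by
  set M : ℝ := max (max x₀ B) 2 with hM
  have hM2 : 2 ≤ M := le_max_right _ _
  have hM0 : 0 < M := by linarith
  set ℓ : ℝ := Real.logb 3 M with hℓ
  have hℓ0 : 0 ≤ ℓ := Real.logb_nonneg (by norm_num) (by linarith)
  refine ⟨e * a + 1 + ℓ, by positivity, fun d hd => ?_⟩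
  have hd1 : (1 : ℝ) ≤ d := by linarith
  have hd0 : (0 : ℝ) < d := by linarith
  have hsplit : d ^ (e * a + 1 + ℓ) = d ^ (e * a) * d * d ^ ℓ := by
    rw [Real.rpow_add hd0, Real.rpow_add hd0, Real.rpow_one]
  have hda : 1 ≤ d ^ (e * a) := Real.one_le_rpow hd1 (by positivity)
  have hdℓ : M ≤ d ^ ℓ := by
    calc M = (3 : ℝ) ^ ℓ := by rw [hℓ, Real.rpow_logb (by norm_num) (by norm_num) hM0]
      _ ≤ d ^ ℓ := Real.rpow_le_rpow (by norm_num) hd (hℓ0)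
  have hdℓ1 : 1 ≤ d ^ ℓ := by linarith
  refine ⟨?_, ?_, ?_⟩
  · calc x₀ ≤ M := le_trans (le_max_left _ _) (le_max_left _ _)
      _ ≤ d ^ ℓ := hdℓ
      _ = 1 * 1 * d ^ ℓ := by ring
      _ ≤ d ^ (e * a) * d * d ^ ℓ := by
          apply mul_le_mul (mul_le_mul hda hd1 zero_le_one (by linarith)) le_rfl (by linarith)
          positivity
      _ = d ^ (e * a + 1 + ℓ) := hsplit.symm
  · calc (d ^ e) ^ a = d ^ (e * a) := by rw [← Real.rpow_mul hd0.le]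
      _ = d ^ (e * a) * 1 * 1 := by ring
      _ ≤ d ^ (e * a) * d * d ^ ℓ := by
          apply mul_le_mul (mul_le_mul_of_nonneg_left hd1 (by linarith)) hdℓ1 zero_le_one
          positivity
      _ = d ^ (e * a + 1 + ℓ) := hsplit.symm
  · calc B * d ≤ M * d := mul_le_mul_of_nonneg_right (le_trans (le_max_right _ _) (le_max_left _ _)) hd0.le
      _ ≤ d ^ ℓ * d := mul_le_mul_of_nonneg_right hdℓ hd0.le
      _ = 1 * d * d ^ ℓ := by ring
      _ ≤ d ^ (e * a) * d * d ^ ℓ := by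
          apply mul_le_mul (mul_le_mul_of_nonneg_right hda hd0.le) le_rfl (by positivity)
          positivity
      _ = d ^ (e * a + 1 + ℓ) := hsplit.symm

/-- `3 ≤ |d_K|` (as a real number) for a number field of degree `> 1`. -/
theorem three_le_natAbs_discr_real (K : Type*) [Field K] [NumberField K] (hK : 1 < Module.finrank ℚ K) :
    (3 : ℝ) ≤ ((NumberField.discr K).natAbs : ℝ) := by
  have h2 := NumberField.abs_discr_gt_two hK
  rw [Nat.cast_natAbs]
  exact_mod_cast (show (3 : ℤ) ≤ |NumberField.discr K| by omega)

/-- `log|d_E| ≤ A log|d_K| ≤ A |d_K|` when `|d_E| ≤ |d_K|^A`. -/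
theorem log_natAbs_discr_le {E K : Type*} [Field E] [NumberField E] [Field K] [NumberField K]
    {A : ℕ} (h : (NumberField.discr E).natAbs ≤ (NumberField.discr K).natAbs ^ A) :
    Real.log ((NumberField.discr E).natAbs : ℝ) ≤ A * ((NumberField.discr K).natAbs : ℝ) := by
  set d : ℝ := ((NumberField.discr K).natAbs : ℝ) with hd
  have hd1 : (1 : ℝ) ≤ d := by
    have h1 := Int.one_le_abs (NumberField.discr_ne_zero K)
    rw [Int.abs_eq_natAbs] at h1
    rw [hd]; exact_mod_cast h1
  have hE1 : (1 : ℝ) ≤ ((NumberField.discr E).natAbs : ℝ) := by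
    have h1 := Int.one_le_abs (NumberField.discr_ne_zero E)
    rw [Int.abs_eq_natAbs] at h1
    exact_mod_cast h1
  have hlog : Real.log ((NumberField.discr E).natAbs : ℝ) ≤ A * Real.log d := by
    rw [← Real.log_pow]
    refine Real.log_le_log (by linarith) ?_
    rw [hd]; exact_mod_cast h
  have hlogd : Real.log d ≤ d := (Real.log_le_sub_one_of_pos (by linarith)).trans (by linarith)
  have hA : (0 : ℝ) ≤ A := Nat.cast_nonneg A
  nlinarith

/-! ### The least prime of splitting type `(1,2)` in a non-Galois cubic field -/

/-- **The least partially split prime of a non-Galois cubic field, unconditionally**: there is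
`L > 0` such that every cubic number field `K` that is not Galois over `ℚ` has a prime `p ≤ |d_K|^{L}`,
`p ∤ d_K`, with splitting type `T_K(p) = {1, 2}` (Frobenius in the class of transpositions of `S₃`).
[cite: LagariasMontgomeryOdlyzko1979, Theorem 1.1] -/
theorem exists_partialPrime_le :
    ∃ L : ℝ, 0 < L ∧ ∀ (K : Type) [Field K] [NumberField K], Module.finrank ℚ K = 3 →
      ¬ IsGalois ℚ K →
        ∃ p : ℕ, p.Prime ∧ (p : ℝ) ≤ ((NumberField.discr K).natAbs : ℝ) ^ L ∧
          ¬ ((p : ℤ) ∣ NumberField.discr K) ∧ splittingType K p = {1, 2} := by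
  classical
  obtain ⟨a, ha1, hup⟩ := chebyshevThetaIdeal_le_uniform 2 (by norm_num) (η := 1 / 10) (by norm_num)
  obtain ⟨x₀, hx₀2, hθQ⟩ := chebyshevTheta_eventually_ge (η := 1 / 10) (by norm_num)
  obtain ⟨A, hclos⟩ := stub_cubicClosure
  obtain ⟨L, hL, hthr⟩ := exists_exponent_rpow (A + 2) a x₀ (3 * A) (by positivity) (by linarith)
  refine ⟨L, hL, fun K _ _ h3 hKng => ?_⟩
  obtain ⟨N, _, _, hGal, h6, hna, ⟨K', ⟨e⟩⟩, ⟨k, hk⟩, hdN⟩ := hclos K h3 hKng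
  haveI := hGal
  have hK' : Module.finrank ℚ K' = 3 := by rw [← e.toLinearEquiv.finrank_eq, h3]
  set d : ℝ := ((NumberField.discr K).natAbs : ℝ) with hd
  have hd3 : (3 : ℝ) ≤ d := three_le_natAbs_discr_real K (by rw [h3]; norm_num)
  have hd0 : (0 : ℝ) < d := by linarith
  obtain ⟨hx₀, hxQ, hxB⟩ := hthr d hd3
  set x : ℝ := d ^ L with hx
  -- `Q_k ≤ d^{A+2}`: `Q_k = 4|d_k|`, `d_k ∣ d_N`, `|d_N| ≤ d^A`, `4 ≤ d²`
  have hdisc' : NumberField.discr K' = NumberField.discr K := (NumberField.discr_eq_discr_of_algEquiv K e).symm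
  have hdkN : ((NumberField.discr k).natAbs : ℝ) ≤ ((NumberField.discr N).natAbs : ℝ) := by
    have hdvd := NumberField.discr_dvd_discr k N
    exact_mod_cast Nat.le_of_dvd (Int.natAbs_pos.mpr (NumberField.discr_ne_zero N))
      (Int.natAbs_dvd_natAbs.mpr hdvd)
  have hdNK : ((NumberField.discr N).natAbs : ℝ) ≤ d ^ (A : ℝ) := by
    rw [Real.rpow_natCast, hd]; exact_mod_cast hdN
  have hQk : ThornerZaman.condQn k ≤ d ^ ((A : ℝ) + 2) := by
    rw [ThornerZaman.condQn, hk, ← Int.cast_abs, Int.abs_eq_natAbs, Int.cast_natCast,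
      Real.rpow_add hd0, Real.rpow_two]
    push_cast
    have h4 : (4 : ℝ) ≤ d ^ 2 := by nlinarith
    have := hdkN.trans hdNK
    calc ((NumberField.discr k).natAbs : ℝ) * (2 : ℝ) ^ 2 = ((NumberField.discr k).natAbs : ℝ) * 4 := by
          norm_num
      _ ≤ d ^ (A : ℝ) * d ^ 2 := mul_le_mul this h4 (by norm_num) (by positivity)
  have hQ' : ThornerZaman.condQn k ^ a ≤ x := by
    have hQ12 : (12 : ℝ) ≤ ThornerZaman.condQn k :=
      ThornerZaman.twelve_le_condQn (K := k) (by rw [hk]; norm_num)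
    calc ThornerZaman.condQn k ^ a ≤ (d ^ ((A : ℝ) + 2)) ^ a :=
          Real.rpow_le_rpow (by linarith) hQk (by linarith)
      _ ≤ x := hxQ
  -- the analytic inputs at `x`
  have h1 : 9 / 10 * x ≤ Chebyshev.theta x := by
    have := hθQ x hx₀; norm_num at this ⊢; linarith
  have h2 : degreeOneTheta k x ≤ 11 / 10 * x := by
    have := (degreeOneTheta_le_chebyshevThetaIdeal k x).trans (hup k hk x hQ')
    norm_num at this ⊢; linarith
  have h4 : 2 * Real.log ((NumberField.discr N).natAbs : ℝ) < 7 / 10 * x := by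
    have := log_natAbs_discr_le hdN
    nlinarith
  -- the sum
  have hsum := two_mul_partialSum_ge h6 hna K' k hK' hk x
  have hpos : 0 < ∑ p ∈ (Nat.primesLE ⌊x⌋₊).filter
      (fun p : ℕ => ¬ ((p : ℤ) ∣ NumberField.discr N) ∧ (splittingType K' p).count 1 = 1),
      Real.log p := by
    linarith
  obtain ⟨p, hp, hpx, hpN, hcount⟩ := exists_prime_of_sum_log_pos hpos
  have hdvd : ¬ ((p : ℤ) ∣ NumberField.discr K) := fun h =>
    hpN (h.trans (hdisc' ▸ NumberField.discr_dvd_discr K' N))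
  refine ⟨p, hp, hpx, hdvd, ?_⟩
  rw [ArithmeticallyEquivalent.of_algEquiv e p hp]
  exact splittingType_eq_of_count_one_eq_one hK' hp (hdisc'.symm ▸ hdvd) hcount

/-! ### The least inert prime of a cyclic cubic field -/

/-- **The least inert prime of a cyclic cubic field, unconditionally**: there is `L > 0` such that
every Galois (cyclic) cubic number field `K` has a rational prime `p ≤ |d_K|^{L}` with `p𝓞_K` a prime
ideal (Frobenius `≠ 1`, density `2/3`). [cite: LagariasMontgomeryOdlyzko1979, Theorem 1.1] -/
theorem exists_inertPrime_le_of_isGalois :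
    ∃ L : ℝ, 0 < L ∧ ∀ (K : Type) [Field K] [NumberField K] [IsGalois ℚ K], Module.finrank ℚ K = 3 →
      ∃ p : ℕ, p.Prime ∧ (p : ℝ) ≤ ((NumberField.discr K).natAbs : ℝ) ^ L ∧
        (Ideal.span {(p : 𝓞 K)}).IsPrime := by
  classical
  obtain ⟨a, ha1, hup⟩ := chebyshevThetaIdeal_le_uniform 3 (by norm_num) (η := 1 / 10) (by norm_num)
  obtain ⟨x₀, hx₀2, hθQ⟩ := chebyshevTheta_eventually_ge (η := 1 / 10) (by norm_num)
  obtain ⟨L, hL, hthr⟩ := exists_exponent_rpow 4 a x₀ 3 (by norm_num) (by linarith)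
  refine ⟨L, hL, fun K _ _ _ h3 => ?_⟩
  have hK1 : 1 < Module.finrank ℚ K := by rw [h3]; norm_num
  set d : ℝ := ((NumberField.discr K).natAbs : ℝ) with hd
  have hd3 : (3 : ℝ) ≤ d := three_le_natAbs_discr_real K hK1
  have hd0 : (0 : ℝ) < d := by linarith
  obtain ⟨hx₀, hxQ, hxB⟩ := hthr d hd3
  set x : ℝ := d ^ L with hx
  have hQ' : ThornerZaman.condQn K ^ a ≤ x := by
    have hQ4 := condQn_le_natAbs_discr_rpow K hK1
    rw [h3] at hQ4
    have e4 : (1 : ℝ) + ((3 : ℕ) : ℝ) * Real.log ((3 : ℕ) : ℝ) / Real.log 3 = 4 := by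
      have hlog3 : Real.log 3 ≠ 0 := (Real.log_pos (by norm_num)).ne'
      push_cast; field_simp; ring
    rw [e4] at hQ4
    have hQ12 : (12 : ℝ) ≤ ThornerZaman.condQn K := ThornerZaman.twelve_le_condQn (K := K) hK1
    calc ThornerZaman.condQn K ^ a ≤ (d ^ (4 : ℝ)) ^ a :=
          Real.rpow_le_rpow (by linarith) hQ4 (by linarith)
      _ ≤ x := hxQ
  have h1 : 9 / 10 * x ≤ Chebyshev.theta x := by
    have := hθQ x hx₀; norm_num at this ⊢; linarith
  have h2 : degreeOneTheta K x ≤ 11 / 10 * x := by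
    have := (degreeOneTheta_le_chebyshevThetaIdeal K x).trans (hup K h3 x hQ')
    norm_num at this ⊢; linarith
  have h4 : 3 * Real.log d < 27 / 10 * x - 11 / 10 * x := by
    have hlogd : Real.log d ≤ d := (Real.log_le_sub_one_of_pos hd0).trans (by linarith)
    nlinarith
  -- pointwise: at `p ∤ d_K`, `a_K(p) ∈ {0, 3}` so `3·𝟙[a_K(p) = 0] = 3 − a_K(p)`
  have hsum := sum_le_of_pointwise (N := K) 3 (by norm_num)
    (fun p => 3 - (((splittingType K p).count 1 : ℕ) : ℝ))
    (fun p => (splittingType K p).count 1 = 0) ⌊x⌋₊ ?_ ?_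
  rotate_left
  · intro p hp hdp
    have hp' := (Nat.mem_primesLE.mp hp).2
    rcases count_one_splittingType_eq_zero_or_eq_finrank (N := K) hp' hdp with h0 | h3'
    · rw [if_pos h0, h0]; norm_num
    · rw [h3] at h3'
      rw [if_neg (by omega), h3']; norm_num
  · intro p hp _
    have hK0 : (0 : ℝ) ≤ (((splittingType K p).count 1 : ℕ) : ℝ) := Nat.cast_nonneg _
    linarith
  have hrew : ∑ p ∈ Nat.primesLE ⌊x⌋₊, (3 - (((splittingType K p).count 1 : ℕ) : ℝ)) * Real.log p =
      3 * Chebyshev.theta x - degreeOneTheta K x := by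
    rw [Chebyshev.theta_eq_sum_primesLE, degreeOneTheta_eq_sum_count_one, Finset.mul_sum,
      ← Finset.sum_sub_distrib]
    exact Finset.sum_congr rfl fun p _ => by ring
  rw [hrew] at hsum
  have hpos : 0 < ∑ p ∈ (Nat.primesLE ⌊x⌋₊).filter
      (fun p : ℕ => ¬ ((p : ℤ) ∣ NumberField.discr K) ∧ (splittingType K p).count 1 = 0),
      Real.log p := by
    rw [← hd] at hsum
    linarith
  obtain ⟨p, hp, hpx, hpK, hcount⟩ := exists_prime_of_sum_log_pos hpos
  exact ⟨p, hp, hpx, isPrime_span_of_count_one_eq_zero h3 hp hpK hcount⟩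

end Summit.QuantumAdvantage.QuantumAdvantage.Theorems.DegreeOnePrimesEscape

end
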